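import Summits.Ventures.YMGap.RobustBall.BoundaryDecayTorus
import Summits.Ventures.YMGap.RobustBall.OneStateReflection
import Summits.Ventures.YMGap.RobustBall.PerturbedGaugeInvariance
import Literature.MathematicalPhysics.QuantumFieldTheory.Balaban1983to89.InfiniteVolumeSufficient
import HarnessLib

/-!
# Venture YMGap, track ROBUST-BALL — ONE STATE AT A RATE, capstone: `SU(2)` lattice Yang–Mills on `ℤ⁴` at `|β_W| ≤ 1/9` —
# ONE state, fully symmetric, gauge invariant, reached exponentially fast from every finite volume and every torus

HONEST FRAMING. WHAT THIS IS: a venture file (cell `pub-ymgap`, track Y2 ROBUST-BALL, seat ds-3, theorems only) packaging the seat's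
gen-11/gen-12 one-state theorems for the Wilson action in ONE quotable statement (`su2_wilson_oneState_master_rate`): for every
`|β_W| ≤ 1/9` there is ONE probability measure `μ` on `SU(2)^{links(ℤ⁴)}` such that
(1) `ymGibbsMeasures = {μ}` (the unique DLR state), `infiniteVolumeLimitPoints = {μ}` (the only torus limit point) and
    `QuantumLattice.IsInfiniteVolumeLimit … μ`: the FULL sequence of torus states `(ℤ/(L+1))⁴` converges to `μ` on every bounded continuous
    cylinder observable (lit `hasUniqueInfiniteVolumeLimit_of_subsingleton`);
(2) `μ` is invariant under every lattice translation, every permutation of the axes and every axis reflection (the hyperoctahedral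
    space group) — `oneState_hyperoctahedral_of_massGapAt`;
(3) `μ` is invariant under every lattice gauge transformation — `map_gaugeTransformZd_eq_of_mem_ymGibbsMeasures` (true for every DLR
    state at every coupling);
(4) for every box `[−n, n]⁴`, EVERY boundary field `η` and every Lipschitz cylinder `F` (constant `K`) based in `[−m, m]⁴`:
    `|∫ F dγ_{boxLinks 4 n}(· | η) − ∫ F dμ| ≤ 2√2 · K · #Δ · 2^{−(n−m)}` — `su2_wilson_box_abs_le_oneNinth`;
(5) for every torus side `L > 2(n+1)`, `m ≤ n`: `|⟨F ∘ torusLift⟩_{(ℤ/L)⁴, β_W} − ∫ F dμ| ≤ 2√2 · K · #Δ · 2^{−(n−m)}` —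
    `su2_wilson_torus_abs_le_oneNinth` (TWO-SIDED in `β_W`).
The every-`N` twin at 't Hooft `|β| < 1/48` (`suN_wilson_oneState_master_rate`, `d = 4`, ratio `max(ρ,½)`, `ρ = 18|β|/(1/2 − 6|β|)`).
WHAT THIS IS NOT: strong-coupling LATTICE statements (uniqueness window `|β_W| ≤ 9/25`, rate window `β_W < 2/9`); the rates are
Dobrushin-comparison lower bounds; nothing about the continuum limit, a spectral gap or the Clay Millennium problem.

References: the track's `WilsonOneStateSymmetry.lean`, `OneStateReflection.lean`, `PerturbedGaugeInvariance.lean`, `BoundaryDecayKR.lean`,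
`BoundaryDecayTorus.lean`; H.-O. Georgii (2011), §5.1, Remark 8.26.
-/

noncomputable section

open MeasureTheory Filter Function ProbabilityTheory
open scoped NNReal
open Literature.Probability.LatticeModels hiding configShift configShift_apply
open Literature.MathematicalPhysics.QuantumLattice
open Literature.MathematicalPhysics.QuantumFieldTheory hiding ZdEdge Site
open Summit.QuantumFields.GaugeBoot (configSiteReflect)

namespace Summit.Ventures.YMGap.RobustBall

/-- ★★★ **`SU(2)` LATTICE YANG–MILLS ON `ℤ⁴` AT `|β_W| ≤ 1/9` (tree coupling `β_W/2`): ONE STATE, FULLY SYMMETRIC, GAUGE INVARIANT,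
REACHED EXPONENTIALLY FAST FROM EVERY FINITE VOLUME (ANY BOUNDARY FIELD) AND FROM EVERY TORUS; THE FULL TORUS SEQUENCE
CONVERGES TO IT.** See the module docstring for the clauses. [folklore] -/
theorem su2_wilson_oneState_master_rate {βW : ℝ} (h : |βW| ≤ 1 / 9) :
    ∃ μ : Measure (LGConfig 4 (SUN 2)),
      ymGibbsMeasures (d := 4) (fundamentalRep (Fin 2)) (βW / 2) = {μ} ∧
      infiniteVolumeLimitPoints (d := 4) (fundamentalRep (Fin 2)) (βW / 2) = {μ} ∧
      Literature.MathematicalPhysics.QuantumLattice.IsInfiniteVolumeLimit (d := 4) (fundamentalRep (Fin 2)) (βW / 2) μ ∧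
      (IsZdTranslationInvariant μ ∧ (∀ π : Equiv.Perm (Fin 4), μ.map (configPermZd π) = μ) ∧
        ∀ i : Fin 4, μ.map (configSiteReflect i) = μ) ∧
      (∀ g : Site 4 → SUN 2, μ.map (gaugeTransformZd g) = μ) ∧
      (∀ (m n : ℕ) (η : LGConfig 4 (SUN 2)) (F : LGConfig 4 (SUN 2) → ℝ) (Δ : Finset (ZdEdge 4)) (K : ℝ≥0),
        IsLipschitzCylinder (fundamentalRep (Fin 2)) F Δ K → Δ ⊆ boxLinks 4 m →
          |(∫ U, F U ∂(ymSpecification (d := 4) (fundamentalRep (Fin 2)) (βW / 2) (boxLinks 4 n) η)) - ∫ U, F U ∂μ| ≤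
            2 * Real.sqrt 2 * K * Δ.card * (1 / 2 : ℝ) ^ (n - m)) ∧
      (∀ (m n L : ℕ) [NeZero L], m ≤ n → 2 * (n + 1) < L →
        ∀ (F : LGConfig 4 (SUN 2) → ℝ) (Δ : Finset (ZdEdge 4)) (K : ℝ≥0),
        IsLipschitzCylinder (fundamentalRep (Fin 2)) F Δ K → Δ ⊆ boxLinks 4 m →
          |wilsonExpectation (fundamentalRep (Fin 2)) (βW / 2) (toTorusObservable L F) - ∫ U, F U ∂μ| ≤
            2 * Real.sqrt 2 * K * Δ.card * (1 / 2 : ℝ) ^ (n - m)) := by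
  have hb : |βW / 2| ≤ 9 / 50 := by rw [abs_div, abs_two]; linarith
  obtain ⟨μ, hG, hL, hT, hP, hR⟩ := su2_wilson_oneState_hyperoctahedral hb
  have hμ : μ ∈ ymGibbsMeasures (d := 4) (fundamentalRep (Fin 2)) (βW / 2) := by rw [hG]; exact Set.mem_singleton μ
  obtain ⟨μ', hμ'lim, hμ'pts⟩ := hasUniqueInfiniteVolumeLimit_of_subsingleton (d := 4) (fundamentalRep (Fin 2))
    (continuous_fundamentalRep (Fin 2)) (βW / 2) (by rw [hG]; exact Set.subsingleton_singleton)
  have hμ'μ : μ' = μ := Set.singleton_eq_singleton_iff.1 (hμ'pts.symm.trans hL)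
  rw [hμ'μ] at hμ'lim
  exact ⟨μ, hG, hL, hμ'lim, ⟨hT, hP, hR⟩, fun g => map_gaugeTransformZd_eq_of_mem_ymGibbsMeasures _ _ hμ g,
    fun m n η F Δ K hF hΔ => su2_wilson_box_abs_le_oneNinth h hμ n η hF hΔ,
    fun m n L _ hmn hL2 F Δ K hF hΔ => su2_wilson_torus_abs_le_oneNinth h hμ hmn hL2 hF hΔ⟩

/-- ★★ **EVERY `N ≥ 2`, `d = 4`, 't Hooft `|β| < 1/48` (tree coupling `N β`), with `ρ ≥ 18|β|/(1/2 − 6|β|)`, `ρ < 1`**: ONE state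
(unique DLR = the only torus limit point = the limit of the full torus sequence), hyperoctahedrally symmetric, gauge invariant, reached from every box with any boundary field and
from every torus at the geometric ratio `max(ρ, ½)` per unit of free room. Uniqueness from the sharp window `|β| < 1/32`
(`suN_wilson_oneState_hyperoctahedral_sharp`). [folklore] -/
theorem suN_wilson_oneState_master_rate {N : ℕ} (hN : 2 ≤ N) {β ρ : ℝ} (hβ : |β| < 1 / 48)
    (hρ : 18 * |β| / (1 / 2 - 6 * |β|) ≤ ρ) (hρ1 : ρ < 1) :
    ∃ μ : Measure (LGConfig 4 (SUN N)),
      ymGibbsMeasures (d := 4) (fundamentalRep (Fin N)) ((N : ℝ) * β) = {μ} ∧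
      infiniteVolumeLimitPoints (d := 4) (fundamentalRep (Fin N)) ((N : ℝ) * β) = {μ} ∧
      Literature.MathematicalPhysics.QuantumLattice.IsInfiniteVolumeLimit (d := 4) (fundamentalRep (Fin N)) ((N : ℝ) * β) μ ∧
      (IsZdTranslationInvariant μ ∧ (∀ π : Equiv.Perm (Fin 4), μ.map (configPermZd π) = μ) ∧
        ∀ i : Fin 4, μ.map (configSiteReflect i) = μ) ∧
      (∀ g : Site 4 → SUN N, μ.map (gaugeTransformZd g) = μ) ∧
      (∀ (m n : ℕ) (η : LGConfig 4 (SUN N)) (F : LGConfig 4 (SUN N) → ℝ) (Δ : Finset (ZdEdge 4)) (K : ℝ≥0),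
        IsLipschitzCylinder (fundamentalRep (Fin N)) F Δ K → Δ ⊆ boxLinks 4 m →
          |(∫ U, F U ∂(ymSpecification (d := 4) (fundamentalRep (Fin N)) ((N : ℝ) * β) (boxLinks 4 n) η)) - ∫ U, F U ∂μ| ≤
            2 * Real.sqrt N * K * Δ.card * (max ρ (1 / 2)) ^ (n - m)) ∧
      (∀ (m n L : ℕ) [NeZero L], m ≤ n → 2 * (n + 1) < L →
        ∀ (F : LGConfig 4 (SUN N) → ℝ) (Δ : Finset (ZdEdge 4)) (K : ℝ≥0),
        IsLipschitzCylinder (fundamentalRep (Fin N)) F Δ K → Δ ⊆ boxLinks 4 m →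
          |wilsonExpectation (fundamentalRep (Fin N)) ((N : ℝ) * β) (toTorusObservable L F) - ∫ U, F U ∂μ| ≤
            2 * Real.sqrt N * K * Δ.card * (max ρ (1 / 2)) ^ (n - m)) := by
  have hsharp : |β| < HessianSharp.sharpThresholdSU 4 := by
    calc |β| < 1 / 48 := hβ
      _ ≤ HessianSharp.sharpThresholdSU 4 := by unfold HessianSharp.sharpThresholdSU; norm_num
  obtain ⟨μ, hG, hL, hT, hP, hR⟩ := suN_wilson_oneState_hyperoctahedral_sharp (d := 4) (by norm_num) hN hsharp
  have hμ : μ ∈ ymGibbsMeasures (d := 4) (fundamentalRep (Fin N)) ((N : ℝ) * β) := by rw [hG]; exact Set.mem_singleton μ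
  obtain ⟨μ', hμ'lim, hμ'pts⟩ := hasUniqueInfiniteVolumeLimit_of_subsingleton (d := 4) (fundamentalRep (Fin N))
    (continuous_fundamentalRep (Fin N)) ((N : ℝ) * β) (by rw [hG]; exact Set.subsingleton_singleton)
  have hμ'μ : μ' = μ := Set.singleton_eq_singleton_iff.1 (hμ'pts.symm.trans hL)
  rw [hμ'μ] at hμ'lim
  exact ⟨μ, hG, hL, hμ'lim, ⟨hT, hP, hR⟩, fun g => map_gaugeTransformZd_eq_of_mem_ymGibbsMeasures _ _ hμ g,
    fun m n η F Δ K hF hΔ => suN_wilson_box_dim4 hN hβ hρ hρ1 hμ n η hF hΔ,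
    fun m n L _ hmn hL2 F Δ K hF hΔ => suN_wilson_torus_dim4 hN hβ hρ hρ1 hμ hmn hL2 hF hΔ⟩

end Summit.Ventures.YMGap.RobustBall

end
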